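import Mathlib
import Summits.Ventures.PercRepro2.HCov
import Summits.Ventures.PercRepro2.A3Fibre
import Summits.Ventures.PercRepro2.A3FibreA
import Summits.Ventures.PercRepro2.A3RootEdge
import Summits.Ventures.PercRepro2.A3RootEdgeMeans
import Summits.Ventures.PercRepro2.A3RootEdgeClosure

/-!
# The root-edge closure of (MEANS-a₃) for any set of `a₁`-root edges
(blind cell PercRepro2, p5 g13; `proofs/P5-ROOTEDGE.md` §6)

* `prob_PD_le_update_zero`: deleting a root edge at `a₃` cannot decrease `D = P(PD)`
  (`D = (1 − p e)·D₀`), so the side condition `D > 0` of `A3Between_of_update_zero` propagates;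
* **`A3Between_of_zeroOn`**: for a finset `T` of edges `{a₁, a₃}` and `D = P_p(PD) > 0`,
  `A3Between (zeroOn p T) → A3Between p` — (MEANS-a₃) on the instance with every edge of `T`
  deleted implies (MEANS-a₃) on the instance itself (induction on `T`, `zeroOn_insert`).
-/

namespace Summit.Ventures.PercRepro2

open UnionCluster

namespace CovForm

namespace RootEdge

open CCT A3Fibre

section All

variable {V : Type*} {E : Type*} [Fintype V] [DecidableEq V] [Fintype E] [DecidableEq E]
  {R : Type*} [Field R] [LinearOrder R] [IsStrictOrderedRing R]

variable {ends : E → Sym2 V} {e : E} {a₁ a₂ a₃ : V}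

omit [Fintype V] [DecidableEq V] [Fintype E] [LinearOrder R] [IsStrictOrderedRing R] in
/-- `zeroOn` and `update · e 0` commute. -/
lemma zeroOn_update_zero (p : E → R) (e : E) (T : Finset E) :
    zeroOn (Function.update p e 0) T = Function.update (zeroOn p T) e 0 := by
  funext e'
  by_cases he : e' = e
  · subst he; simp [zeroOn]
  · simp [zeroOn, Function.update_of_ne he]

omit [Fintype V] [DecidableEq V] in
/-- Deleting a root edge at `a₃` cannot decrease `D`. -/
lemma prob_PD_le_update_zero (p : E → R) (hp : IsProbVec p) (hends : ends e = s(a₁, a₃)) :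
    prob p (PDEvent ends a₁ a₂ a₃) ≤ prob (Function.update p e 0) (PDEvent ends a₁ a₂ a₃) := by
  have hp₀ : IsProbVec (Function.update p e 0) := hp.update e le_rfl zero_le_one
  rw [prob_PD_eq_pin p hends]
  have h0 := prob_nonneg hp₀ (PDEvent ends a₁ a₂ a₃)
  have ht := hp.nonneg e
  nlinarith

/-- **(MEANS-a₃) after deleting any set of `a₁`-root edges implies (MEANS-a₃)** (for `D > 0`). -/
theorem A3Between_of_zeroOn (p : E → R) (hp : IsProbVec p) (o b : V) (T : Finset E)
    (hT : ∀ e ∈ T, ends e = s(a₁, a₃)) (hD : 0 < prob p (PDEvent ends a₁ a₂ a₃))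
    (h₀ : A3Between (zeroOn p T) ends o a₁ a₂ a₃ b) : A3Between p ends o a₁ a₂ a₃ b := by
  induction T using Finset.induction_on generalizing p with
  | empty => simpa only [zeroOn_empty] using h₀
  | insert e T _ ih =>
    have hp₀ : IsProbVec (Function.update p e 0) := hp.update e le_rfl zero_le_one
    have he : ends e = s(a₁, a₃) := hT e (Finset.mem_insert_self e T)
    have hD₀ : 0 < prob (Function.update p e 0) (PDEvent ends a₁ a₂ a₃) :=
      lt_of_lt_of_le hD (prob_PD_le_update_zero p hp he)
    refine A3Between_of_update_zero p hp o b he hD₀ ?_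
    refine ih (Function.update p e 0) hp₀ (fun e' he' => hT e' (Finset.mem_insert_of_mem he'))
      hD₀ ?_
    rw [zeroOn_update_zero, ← zeroOn_insert]
    exact h₀

end All

end RootEdge

end CovForm

end Summit.Ventures.PercRepro2
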